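import Summits.CriticalPhenomena.PercolationContinuityZ3.Theorems.PercNearOneGluingNoHeavyLowerTailFreeSourceExchange
import Summits.CriticalPhenomena.PercolationContinuityZ3.Theorems.PercNearOneGluingNoHeavyLowerTailSectorPairTransfer
import HarnessLib

/-!
# `NoHeavyLowerTail` (stmt-CriticalPhenomena-4575) — the three four-terminal BHK lemmas of the ONE-LAYER observer theorem
# (depth prover `nh-dp-commonrelay`, gen 9)

Support file (`--supports stmt-CriticalPhenomena-4575`); no definitions, no named facts, no sorries.

CONTEXT (memo RESIDUAL-gen9.md §9b).  For an observer `o` adjacent only to the three relays (hair weights `q, p, r` to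
`a₁, a₂, a₃`), integrating out the star of `o` turns the division-free (Y13) margin into
`Δ = p q (1−p)(1−q)(1−r) · μ⁻(N₂) · Q(p,q,r)`, `Q` bilinear in `(p,q)`, whose four corner quadratics are explicit nonnegative
combinations of atoms of the four-terminal law of `{a₁,a₂,a₃,b}` in `G ∖ o` and of the THREE exchange quantities proved here
(stated for an arbitrary weighted graph — apply them to `G ∖ o`):

* `oll_repellerSwallow`  (L1):  `μ(Z ∩ T)·μ(R ∩ B) ≥ μ(Z ∩ B)·μ(R ∩ T)`, `Z = R ∩ {a₃↔a₂}` — when the repeller's cluster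
  contains the second source, the odds "b with the repeller : b with the source" are larger than in the whole world `R`;
  equivalently (subtracting from `μ(R∩B)μ(R∩T)`) `μ(N₁₂ ∩ B) μ(R ∩ T) ≥ μ(N₁₂ ∩ T) μ(R ∩ B)`.
* `oll_sourceExchangeJ` (L2):  `μ(R ∩ J ∩ B)·μ(R ∩ T) ≥ μ(R ∩ J ∩ T)·μ(R ∩ B)` — the J-exchange `dJ ≥ 0` of the (Y13) analysis
  (`P(a₁↔a₂ | R, b∈C(a₁)) ≥ P(a₁↔a₂ | R, b∈C(a₃))`); equivalently `μ(R∩J∩B) μ(N₁∩T) ≥ μ(R∩J∩T) μ(N₁∩B)`.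
* `oll_pairSwallow`      (L3):  `μ(N₁ ∩ B)·μ(Z₂₃ ∩ T) ≥ μ(Z₂₃ ∩ B)·μ(N₁ ∩ T)`, `Z₂₃ = N₁ ∩ {a₂↔a₃}`; equivalently
  `μ(M ∩ B) μ(Z₂₃ ∩ T) ≥ μ(Z₂₃ ∩ B) μ(M ∩ T)`.

Here `R = {a₁ ↮ a₃}`, `N₁ = {a₁ ↮ a₂, a₃}`, `N₁₂ = R ∩ {a₃ ↮ a₂}`, `M = N₁ ∩ {a₂ ↮ a₃}`, `B = {a₁↔b}`, `T = {a₃↔b}`, `J = {a₁↔a₂}`.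
Each is the quotient of TWO van den Berg–Häggström–Kahn inequalities (Thm 1.3 for one cluster and Thm 1.4 across the two
clusters, in the tree as `stub_bhkSets` / `bhkMenu_one` / `obs_bhkCross`), i.e. an instance of their Theorem 1.5.
[cite: VandenbergHaggstromKahn2005, Thm. 1.3 (p. 6), Thm. 1.4 (p. 7), Thm. 1.5 (p. 7); KozmaNitzan2024, Question 7 (p. 36)]
-/

namespace Summit.CriticalPhenomena.PercolationContinuityZ3.Theorems

open MeasureTheory Set Literature.Probability.LatticeModels Literature.Probability.Percolation

noncomputable section

open Classical

variable {n : ℕ}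

/-! ### Bookkeeping (the set identities `{S ↮ X} = R` are `sector_sep11_set/finset`, `sectorPair_sep_set` of the sector files) -/

/-- Cancelling a positive common factor: from `a X ≤ a Y` with `0 ≤ a`, and `X ≤ Y` whenever `a = 0` is excluded by
`X = 0`, conclude `X ≤ Y` (bookkeeping for the quotient of two BHK inequalities). [folklore] -/
theorem oll_cancel {a X Y : ℝ} (ha : 0 ≤ a) (hY : 0 ≤ Y) (h : a * X ≤ a * Y) (h0 : a = 0 → X = 0) : X ≤ Y := by
  by_cases haz : a = 0
  · rw [h0 haz]; exact hY
  · exact le_of_mul_le_mul_left h (lt_of_le_of_ne ha (Ne.symm haz))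

/-! ### L1: the repeller swallowing the second source -/

/-- **L1 (`oll_repellerSwallow`): `μ(R ∩ {a₃↔a₂} ∩ {a₁↔b}) · μ(R ∩ {a₃↔b}) ≤ μ(R ∩ {a₃↔a₂} ∩ {a₃↔b}) · μ(R ∩ {a₁↔b})`**,
`R = {a₁ ↮ a₃}`.  BHK Thm 1.3 for `C(a₃)` given `a₃ ↮ a₁` (`{a₃↔a₂}`, `{a₃↔b}` positively correlated) times BHK Thm 1.4
(`{a₁↔b}` vs `{a₃↔a₂}` negatively correlated), divided by `μ(R) μ(R ∩ {a₃↔a₂})`.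
[cite: VandenbergHaggstromKahn2005, Thms. 1.3–1.5 (pp. 6–7)] -/
theorem oll_repellerSwallow (w : Sym2 (Fin n) → unitInterval) (b a₁ a₂ a₃ : Fin n) (h13 : a₁ ≠ a₃) :
    (prodBernoulli w).real ((openConn a₁ a₃)ᶜ ∩ (openConn a₃ a₂ ∩ openConn a₁ b)) *
        (prodBernoulli w).real ((openConn a₁ a₃)ᶜ ∩ openConn a₃ b) ≤
      (prodBernoulli w).real ((openConn a₁ a₃)ᶜ ∩ (openConn a₃ a₂ ∩ openConn a₃ b)) *
        (prodBernoulli w).real ((openConn a₁ a₃)ᶜ ∩ openConn a₁ b) := by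
  -- (a) CPA of C(a₃) given a₃ ↮ a₁: μ(R ∩ Z') μ(R ∩ T) ≤ μ(R) μ(R ∩ (Z' ∩ T))
  have hSX : ∀ s ∈ ({a₃} : Finset (Fin n)), s ∉ ({a₁} : Set (Fin n)) := by
    intro s hs
    rw [Finset.mem_singleton] at hs
    subst hs
    simpa using fun h => h13 h.symm
  have hA := bhkMenu_one stub_bhkSets.1 w ({a₃} : Finset (Fin n)) ({a₁} : Set (Fin n))
    {C : Set (Sym2 (Fin n)) | (openGraph C).Reachable a₃ a₂} {C : Set (Sym2 (Fin n)) | (openGraph C).Reachable a₃ b}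
    (bhkMenu_pt_isUpperSet a₃ a₂) (bhkMenu_pt_isUpperSet a₃ b) (openConn a₃ a₂) (openConn a₃ b)
    (fun ω => bhkMenu_pt_mem {a₃} (by simp) a₂ ω) (fun ω => bhkMenu_pt_mem {a₃} (by simp) b ω) hSX
  rw [sectorPair_sep_set] at hA
  -- (b) BHK 1.4: μ(R) μ(R ∩ (B ∩ Z')) ≤ μ(R ∩ B) μ(R ∩ Z')
  have hdis : Disjoint ({a₁} : Finset (Fin n)) {a₃} := by
    rw [Finset.disjoint_singleton_left, Finset.mem_singleton]; exact h13
  have hB := obs_bhkCross w {a₁} {a₃} b (x := a₃) (Finset.mem_singleton_self a₃) a₂ hdis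
  rw [sector_sep11_finset, Finset.set_biUnion_singleton] at hB
  -- names
  set μR := (prodBernoulli w).real ((openConn a₁ a₃)ᶜ : Set (BondConfig (Fin n))) with hμR
  set Zp := (prodBernoulli w).real ((openConn a₁ a₃)ᶜ ∩ openConn a₃ a₂) with hZp
  set Tm := (prodBernoulli w).real ((openConn a₁ a₃)ᶜ ∩ openConn a₃ b) with hTm
  set Bm := (prodBernoulli w).real ((openConn a₁ a₃)ᶜ ∩ openConn a₁ b) with hBm
  set ZT := (prodBernoulli w).real ((openConn a₁ a₃)ᶜ ∩ (openConn a₃ a₂ ∩ openConn a₃ b)) with hZT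
  set ZB := (prodBernoulli w).real ((openConn a₁ a₃)ᶜ ∩ (openConn a₃ a₂ ∩ openConn a₁ b)) with hZB
  have eZB : (prodBernoulli w).real ((openConn a₁ a₃)ᶜ ∩ (openConn a₁ b ∩ openConn a₃ a₂)) = ZB := by
    rw [hZB, Set.inter_comm (openConn a₁ b : Set (BondConfig (Fin n)))]
  rw [eZB] at hB
  -- hA : Zp * Tm ≤ μR * ZT ;  hB : μR * ZB ≤ Bm * Zp
  have h0R : 0 ≤ μR := measureReal_nonneg
  have h0Z : 0 ≤ Zp := measureReal_nonneg
  have h0T : 0 ≤ Tm := measureReal_nonneg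
  have h0B : 0 ≤ Bm := measureReal_nonneg
  have h0ZT : 0 ≤ ZT := measureReal_nonneg
  have h0ZB : 0 ≤ ZB := measureReal_nonneg
  have hprod : (μR * Zp) * (ZB * Tm) ≤ (μR * Zp) * (ZT * Bm) := by
    have := mul_le_mul hB hA (mul_nonneg h0Z h0T) (mul_nonneg h0B h0Z)
    nlinarith [this]
  refine oll_cancel (mul_nonneg h0R h0Z) (mul_nonneg h0ZT h0B) hprod fun hz => ?_
  -- if μR·Zp = 0 then ZB = 0 (ZB ≤ Zp ≤ μR)
  have hZB_le : ZB ≤ Zp := measureReal_mono (Set.inter_subset_inter_right _ Set.inter_subset_left)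
  have hZp_le : Zp ≤ μR := measureReal_mono Set.inter_subset_left
  rcases mul_eq_zero.1 hz with h | h
  · have : Zp = 0 := le_antisymm (h ▸ hZp_le) h0Z
    exact mul_eq_zero_of_left (le_antisymm (this ▸ hZB_le) h0ZB) _
  · exact mul_eq_zero_of_left (le_antisymm (h ▸ hZB_le) h0ZB) _

/-! ### L2: the J-exchange (`dJ ≥ 0`) -/

/-- **L2 (`oll_sourceExchangeJ`): `μ(R ∩ {a₁↔a₂} ∩ {a₃↔b}) · μ(R ∩ {a₁↔b}) ≤ μ(R ∩ {a₁↔a₂} ∩ {a₁↔b}) · μ(R ∩ {a₃↔b})`**,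
i.e. `P(a₁↔a₂ | R, b∈C(a₁)) ≥ P(a₁↔a₂ | R, b∈C(a₃))`.  BHK Thm 1.3 for `C(a₁)` given `a₁ ↮ a₃` (`{a₁↔a₂}`, `{a₁↔b}`) times
BHK Thm 1.4 (`{a₁↔a₂}` vs `{a₃↔b}`), divided by `μ(R) μ(R ∩ {a₁↔a₂})`.
[cite: VandenbergHaggstromKahn2005, Thms. 1.3–1.5 (pp. 6–7)] -/
theorem oll_sourceExchangeJ (w : Sym2 (Fin n) → unitInterval) (b a₁ a₂ a₃ : Fin n) (h13 : a₁ ≠ a₃) :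
    (prodBernoulli w).real ((openConn a₁ a₃)ᶜ ∩ (openConn a₁ a₂ ∩ openConn a₃ b)) *
        (prodBernoulli w).real ((openConn a₁ a₃)ᶜ ∩ openConn a₁ b) ≤
      (prodBernoulli w).real ((openConn a₁ a₃)ᶜ ∩ (openConn a₁ a₂ ∩ openConn a₁ b)) *
        (prodBernoulli w).real ((openConn a₁ a₃)ᶜ ∩ openConn a₃ b) := by
  -- (a) CPA of C(a₁) given a₁ ↮ a₃: μ(R ∩ J) μ(R ∩ B) ≤ μ(R) μ(R ∩ (J ∩ B))
  have hSX : ∀ s ∈ ({a₁} : Finset (Fin n)), s ∉ ({a₃} : Set (Fin n)) := by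
    intro s hs
    rw [Finset.mem_singleton] at hs
    subst hs
    simpa using h13
  have hA := bhkMenu_one stub_bhkSets.1 w ({a₁} : Finset (Fin n)) ({a₃} : Set (Fin n))
    {C : Set (Sym2 (Fin n)) | (openGraph C).Reachable a₁ a₂} {C : Set (Sym2 (Fin n)) | (openGraph C).Reachable a₁ b}
    (bhkMenu_pt_isUpperSet a₁ a₂) (bhkMenu_pt_isUpperSet a₁ b) (openConn a₁ a₂) (openConn a₁ b)
    (fun ω => bhkMenu_pt_mem {a₁} (by simp) a₂ ω) (fun ω => bhkMenu_pt_mem {a₁} (by simp) b ω) hSX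
  rw [sector_sep11_set] at hA
  -- (b) BHK 1.4: μ(R) μ(R ∩ (J ∩ T)) ≤ μ(R ∩ J) μ(R ∩ T)
  have hdis : Disjoint ({a₁} : Finset (Fin n)) {a₃} := by
    rw [Finset.disjoint_singleton_left, Finset.mem_singleton]; exact h13
  have hB := obs_bhkCross w {a₁} {a₃} a₂ (x := a₃) (Finset.mem_singleton_self a₃) b hdis
  rw [sector_sep11_finset, Finset.set_biUnion_singleton] at hB
  set μR := (prodBernoulli w).real ((openConn a₁ a₃)ᶜ : Set (BondConfig (Fin n))) with hμR
  set Jm := (prodBernoulli w).real ((openConn a₁ a₃)ᶜ ∩ openConn a₁ a₂) with hJm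
  set Tm := (prodBernoulli w).real ((openConn a₁ a₃)ᶜ ∩ openConn a₃ b) with hTm
  set Bm := (prodBernoulli w).real ((openConn a₁ a₃)ᶜ ∩ openConn a₁ b) with hBm
  set JB := (prodBernoulli w).real ((openConn a₁ a₃)ᶜ ∩ (openConn a₁ a₂ ∩ openConn a₁ b)) with hJB
  set JT := (prodBernoulli w).real ((openConn a₁ a₃)ᶜ ∩ (openConn a₁ a₂ ∩ openConn a₃ b)) with hJT
  -- hA : Jm * Bm ≤ μR * JB ;  hB : μR * JT ≤ Jm * Tm
  have h0R : 0 ≤ μR := measureReal_nonneg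
  have h0J : 0 ≤ Jm := measureReal_nonneg
  have h0T : 0 ≤ Tm := measureReal_nonneg
  have h0B : 0 ≤ Bm := measureReal_nonneg
  have h0JB : 0 ≤ JB := measureReal_nonneg
  have h0JT : 0 ≤ JT := measureReal_nonneg
  have hprod : (μR * Jm) * (JT * Bm) ≤ (μR * Jm) * (JB * Tm) := by
    have := mul_le_mul hB hA (mul_nonneg h0J h0B) (mul_nonneg h0J h0T)
    nlinarith [this]
  refine oll_cancel (mul_nonneg h0R h0J) (mul_nonneg h0JB h0T) hprod fun hz => ?_
  have hJT_le : JT ≤ Jm := measureReal_mono (Set.inter_subset_inter_right _ Set.inter_subset_left)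
  have hJm_le : Jm ≤ μR := measureReal_mono Set.inter_subset_left
  rcases mul_eq_zero.1 hz with h | h
  · have : Jm = 0 := le_antisymm (h ▸ hJm_le) h0J
    exact mul_eq_zero_of_left (le_antisymm (this ▸ hJT_le) h0JT) _
  · exact mul_eq_zero_of_left (le_antisymm (h ▸ hJT_le) h0JT) _

/-! ### L3: the pair `{a₂,a₃}` swallowing each other, seen from `N₁` -/

/-- **L3 (`oll_pairSwallow`): `μ(N₁ ∩ {a₂↔a₃} ∩ {a₁↔b}) · μ(N₁ ∩ {a₃↔b}) ≤ μ(N₁ ∩ {a₂↔a₃} ∩ {a₃↔b}) · μ(N₁ ∩ {a₁↔b})`**,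
`N₁ = {a₁ ↮ a₂, a₃}`.  BHK Thm 1.3 for the cluster of the SET `{a₂,a₃}` given `{a₂,a₃} ↮ a₁` (`{a₂↔a₃}`, `{a₃↔b}` positively
correlated) times BHK Thm 1.4 (`{a₁↔b}` vs `{a₂↔a₃}`), divided by `μ(N₁) μ(N₁ ∩ {a₂↔a₃})`.
[cite: VandenbergHaggstromKahn2005, Thms. 1.3–1.5 (pp. 6–7)] -/
theorem oll_pairSwallow (w : Sym2 (Fin n) → unitInterval) (b a₁ a₂ a₃ : Fin n) (h12 : a₁ ≠ a₂) (h13 : a₁ ≠ a₃) :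
    (prodBernoulli w).real ((openConn a₁ a₂)ᶜ ∩ (openConn a₁ a₃)ᶜ ∩ (openConn a₂ a₃ ∩ openConn a₁ b)) *
        (prodBernoulli w).real ((openConn a₁ a₂)ᶜ ∩ (openConn a₁ a₃)ᶜ ∩ openConn a₃ b) ≤
      (prodBernoulli w).real ((openConn a₁ a₂)ᶜ ∩ (openConn a₁ a₃)ᶜ ∩ (openConn a₂ a₃ ∩ openConn a₃ b)) *
        (prodBernoulli w).real ((openConn a₁ a₂)ᶜ ∩ (openConn a₁ a₃)ᶜ ∩ openConn a₁ b) := by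
  -- (a) CPA of C({a₂,a₃}) given {a₂,a₃} ↮ a₁: μ(N₁ ∩ Z') μ(N₁ ∩ T) ≤ μ(N₁) μ(N₁ ∩ (Z' ∩ T))
  have hSX : ∀ s ∈ ({a₂, a₃} : Finset (Fin n)), s ∉ ({a₁} : Set (Fin n)) := by
    intro s hs
    simp only [Finset.mem_insert, Finset.mem_singleton] at hs
    simp only [Set.mem_singleton_iff]
    rcases hs with rfl | rfl
    · exact fun h => h12 h.symm
    · exact fun h => h13 h.symm
  have hA := bhkMenu_one stub_bhkSets.1 w ({a₂, a₃} : Finset (Fin n)) ({a₁} : Set (Fin n))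
    {C : Set (Sym2 (Fin n)) | (openGraph C).Reachable a₂ a₃} {C : Set (Sym2 (Fin n)) | (openGraph C).Reachable a₃ b}
    (bhkMenu_pt_isUpperSet a₂ a₃) (bhkMenu_pt_isUpperSet a₃ b) (openConn a₂ a₃) (openConn a₃ b)
    (fun ω => bhkMenu_pt_mem {a₂, a₃} (by simp) a₃ ω) (fun ω => bhkMenu_pt_mem {a₂, a₃} (by simp) b ω) hSX
  rw [fse_sep_pair_set] at hA
  -- (b) BHK 1.4: μ(N₁) μ(N₁ ∩ (B ∩ Z')) ≤ μ(N₁ ∩ B) μ(N₁ ∩ Z')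
  have hdis : Disjoint ({a₁} : Finset (Fin n)) {a₂, a₃} := by
    simp only [Finset.disjoint_singleton_left, Finset.mem_insert, Finset.mem_singleton, not_or]
    exact ⟨h12, h13⟩
  have hB := obs_bhkCross w {a₁} {a₂, a₃} b (x := a₂) (by simp) a₃ hdis
  rw [knThm2_sep_single_finset, Finset.set_biUnion_singleton] at hB
  set μN := (prodBernoulli w).real ((openConn a₁ a₂)ᶜ ∩ (openConn a₁ a₃)ᶜ : Set (BondConfig (Fin n))) with hμN
  set Zp := (prodBernoulli w).real ((openConn a₁ a₂)ᶜ ∩ (openConn a₁ a₃)ᶜ ∩ openConn a₂ a₃) with hZp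
  set Tm := (prodBernoulli w).real ((openConn a₁ a₂)ᶜ ∩ (openConn a₁ a₃)ᶜ ∩ openConn a₃ b) with hTm
  set Bm := (prodBernoulli w).real ((openConn a₁ a₂)ᶜ ∩ (openConn a₁ a₃)ᶜ ∩ openConn a₁ b) with hBm
  set ZT := (prodBernoulli w).real ((openConn a₁ a₂)ᶜ ∩ (openConn a₁ a₃)ᶜ ∩ (openConn a₂ a₃ ∩ openConn a₃ b)) with hZT
  set ZB := (prodBernoulli w).real ((openConn a₁ a₂)ᶜ ∩ (openConn a₁ a₃)ᶜ ∩ (openConn a₂ a₃ ∩ openConn a₁ b)) with hZB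
  have eZB : (prodBernoulli w).real ((openConn a₁ a₂)ᶜ ∩ (openConn a₁ a₃)ᶜ ∩ (openConn a₁ b ∩ openConn a₂ a₃)) = ZB := by
    rw [hZB, Set.inter_comm (openConn a₁ b : Set (BondConfig (Fin n)))]
  rw [eZB] at hB
  -- hA : Zp * Tm ≤ μN * ZT ;  hB : μN * ZB ≤ Bm * Zp
  have h0N : 0 ≤ μN := measureReal_nonneg
  have h0Z : 0 ≤ Zp := measureReal_nonneg
  have h0T : 0 ≤ Tm := measureReal_nonneg
  have h0B : 0 ≤ Bm := measureReal_nonneg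
  have h0ZT : 0 ≤ ZT := measureReal_nonneg
  have h0ZB : 0 ≤ ZB := measureReal_nonneg
  have hprod : (μN * Zp) * (ZB * Tm) ≤ (μN * Zp) * (ZT * Bm) := by
    have := mul_le_mul hB hA (mul_nonneg h0Z h0T) (mul_nonneg h0B h0Z)
    nlinarith [this]
  refine oll_cancel (mul_nonneg h0N h0Z) (mul_nonneg h0ZT h0B) hprod fun hz => ?_
  have hZB_le : ZB ≤ Zp := measureReal_mono (Set.inter_subset_inter_right _ Set.inter_subset_left)
  have hZp_le : Zp ≤ μN := measureReal_mono Set.inter_subset_left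
  rcases mul_eq_zero.1 hz with h | h
  · have : Zp = 0 := le_antisymm (h ▸ hZp_le) h0Z
    exact mul_eq_zero_of_left (le_antisymm (this ▸ hZB_le) h0ZB) _
  · exact mul_eq_zero_of_left (le_antisymm (h ▸ hZB_le) h0ZB) _

end

end Summit.CriticalPhenomena.PercolationContinuityZ3.Theorems
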